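import Summits.MatrixMultiplication.OmegaCensus.STPPCertificateCheck
import Mathlib.Data.ZMod.Basic
import Mathlib.Data.Finset.Image
import Mathlib.Data.Fintype.Basic
import Mathlib.Algebra.BigOperators.Group.Finset.Basic
import Mathlib.Logic.Function.Basic
import Mathlib.Tactic.Ring
import Mathlib.Tactic.Linarith

/-!
# ω-census, STPP law: lifting STPP families along a quotient map ("coset mechanism" of the `(2,2,2)^k` column)

HONEST FRAMING (pub-omega census; verbatim): lottery ticket; floor = certified bounds/negative ranges.
Census STRUCTURE bookkeeping (question Q7 / pre-registration P-024 of the pub-omega cell: the cyclic onset `m_k` of `k`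
simultaneous-TPP triples of 2-subsets, CKSU 2005 Def. 5.1, tree form `IsSTPP`), NOT progress on `ω`: a `(2,2,2)^k` family
certifies no matrix-multiplication bound of interest.

## The inference rule

Let `π : G →+ Q` be a homomorphism of abelian groups and `(Aᵢ, Bᵢ, Cᵢ)_{i<N}` finite subsets of `G`.

* `isSTPP_of_image` — **if the image family `(π Aᵢ, π Bᵢ, π Cᵢ)` is an STPP family in `Q` and in every triple at least
  two of the three sets are mapped injectively by `π`, then `(Aᵢ, Bᵢ, Cᵢ)` is an STPP family in `G`.**  (The image of a
  vanishing Def-5.1 word vanishes, so the `Q`-family forces `i = j = k` and equality of the six IMAGES; the two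
  `π`-injective sets give equality of two of the three pairs, and the word itself then gives the third.)  Nothing is
  asked of the third set of a triple: it may be a full fibre of `π`, of size `|ker π|`, whose image is ONE point.
* `exists_isSTPP_222pow_of_card_eq_two_mul` — hence, for `π` surjective with `|G| = 2|Q|` (every fibre has two
  elements, `card_fiber_mul_card`), **an STPP family in `Q` whose every triple has the size pattern `(1,2,2)`, `(2,1,2)` or
  `(2,2,1)` — the singleton sitting in ANY position, varying with the triple — lifts to a `(2,2,2)^N` family in `G`**:
  the singleton becomes its full fibre (an `H`-coset, `H = ker π` of order `2`), the 2-sets are lifted along a section.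
  `exists_isSTPP_222pow_zmod_two_mul` is the cyclic case `ℤ/2n → ℤ/n` — a NON-split extension when `n` is even
  (`ℤ/64 → ℤ/32`, `ℤ/80 → ℤ/40`, `ℤ/92 → ℤ/46`), so this is not an instance of the product law
  (`STPPProductFamilies.lean`, `STPPTricoloredProduct.lean`: products with a fixed second factor put the coset in the
  SAME position in every triple and need `G ≅ H × Q`).

This is the kernel form of the census's "coset mechanism" (cell STATUS 2026-08-24, P-024 MECHANISM DATUM D1: every
`(2,2,2)^k` witness found in an even cyclic group `ℤ/2n` at `80 ≤ 2n ≤ 96` is a COSET family — each triple contains a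
coset `{x, x+n}` of the order-2 subgroup): a coset family whose cosets occupy at most two of the three positions is
EXACTLY the lift of a singleton-mixed family of `ℤ/n` (the converse direction, descent, holds for such families because
every off-diagonal Def-5.1 word is then `{0,n}`-periodic; it is recorded in the cell's notes and not needed here), and
every singleton-mixed family of `ℤ/n` lifts.  Consequences for the census: a search for `k` singleton-mixed triples in
`ℤ/n` (half the order, a third of the sets singletons) produces `(2,2,2)^k ⊆ ℤ/2n`; conversely tonight's
coset-restricted complete INFEASIBLE cells `ℤ/2n` certify (outside the kernel) that `ℤ/n` has no singleton-mixed
`k`-family.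

* `exists_isSTPP_mixed5_zmod46` / `exists_isSTPP_222pow5_zmod92'` — worked instance: the five triples of `ℤ/46` with patterns
  `(2,2,1),(2,2,1),(2,1,2),(2,1,2),(2,2,1)` obtained by projecting the census witness `exists_isSTPP_222pow5_zmod92`
  (`STPP222Pow5CyclicWitnesses9294.lean`) are an STPP family of `ℤ/46` (kernel `decide`), and the lift theorem returns
  `(2,2,2)⁵ ⊆ ℤ/92` — a second, structural proof of that census row.

References: H. Cohn, R. Kleinberg, B. Szegedy, C. Umans, *Group-theoretic algorithms for matrix multiplication*, FOCS 2005
(arXiv:math/0511460), Def. 5.1 and the product remark of §7 (the nearest printed statement; the quotient form above is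
this seat's, elementary).  Seat pub-omega-stpp-3 (gen 9), 2026-08-24; records HOME `pub-omega-stpp-3-g9/`.  The tree's
`STPPQuotientLift.lean` (stpp-2 gen 6) is the SECTION lift with unchanged cardinalities (`IsSTPP.image_section`); the
fibre-saturation rule here, which GROWS one set per triple from `1` to `|ker π|` elements, is different and new.
-/

open Literature.Computability.AlgebraicComplexity Finset

namespace Summit.MatrixMultiplication.OmegaCensus

section Lift

variable {G Q : Type*} [AddCommGroup G] [AddCommGroup Q] [DecidableEq Q] {N : ℕ}

/-- **STPP families lift along homomorphisms.** Let `π : G →+ Q` and `Aᵢ, Bᵢ, Cᵢ ⊆ G` (`i < N`). If the image family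
`(π Aᵢ, π Bᵢ, π Cᵢ)` satisfies CKSU Def. 5.1 in `Q` and in each triple at least two of the three sets are mapped
injectively by `π`, then `(Aᵢ, Bᵢ, Cᵢ)` satisfies Def. 5.1 in `G`. [cite: CohnKleinbergSzegedyUmans2005, Def. 5.1] -/
theorem isSTPP_of_image (π : G →+ Q) {A B C : Fin N → Finset G}
    (hQ : IsSTPP (fun i => (A i).image π) (fun i => (B i).image π) (fun i => (C i).image π))
    (hinj : ∀ i, (Set.InjOn π (B i) ∧ Set.InjOn π (C i)) ∨ (Set.InjOn π (A i) ∧ Set.InjOn π (C i)) ∨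
      (Set.InjOn π (A i) ∧ Set.InjOn π (B i))) :
    IsSTPP A B C := by
  intro i j k s hs s' hs' t ht t' ht' u hu u' hu' h0
  have h0' : (π s' - π s) + (π t' - π t) + (π u' - π u) = 0 := by
    have := congrArg π h0
    simpa only [map_add, map_sub, map_zero] using this
  obtain ⟨hij, hjk, hss, htt, huu⟩ := hQ i j k (π s) (mem_image_of_mem _ hs) (π s') (mem_image_of_mem _ hs')
    (π t) (mem_image_of_mem _ ht) (π t') (mem_image_of_mem _ ht') (π u) (mem_image_of_mem _ hu)
    (π u') (mem_image_of_mem _ hu') h0'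
  subst hij hjk
  refine ⟨rfl, rfl, ?_⟩
  rcases hinj i with ⟨hB, hC⟩ | ⟨hA, hC⟩ | ⟨hA, hB⟩
  · have ht2 : t = t' := hB (mem_coe.2 ht) (mem_coe.2 ht') htt
    have hu2 : u = u' := hC (mem_coe.2 hu) (mem_coe.2 hu') huu
    subst ht2 hu2
    have hs2 : s = s' := by
      have : s' - s = 0 := by simpa using h0
      exact (sub_eq_zero.1 this).symm
    exact ⟨hs2, rfl, rfl⟩
  · have hs2 : s = s' := hA (mem_coe.2 hs) (mem_coe.2 hs') hss
    have hu2 : u = u' := hC (mem_coe.2 hu) (mem_coe.2 hu') huu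
    subst hs2 hu2
    have ht2 : t = t' := by
      have : t' - t = 0 := by simpa using h0
      exact (sub_eq_zero.1 this).symm
    exact ⟨rfl, ht2, rfl⟩
  · have hs2 : s = s' := hA (mem_coe.2 hs) (mem_coe.2 hs') hss
    have ht2 : t = t' := hB (mem_coe.2 ht) (mem_coe.2 ht') htt
    subst hs2 ht2
    have hu2 : u = u' := by
      have : u' - u = 0 := by simpa using h0
      exact (sub_eq_zero.1 this).symm
    exact ⟨rfl, rfl, hu2⟩

end Lift

/-! ## Fibres and sections of a surjection between finite abelian groups -/

section Fiber

variable {G Q : Type*} [AddCommGroup G] [AddCommGroup Q]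

/-- Membership in the fibre `{g | π g = q}` (as a finset of `G`; no new definition is introduced, the fibre is written
`univ.filter (π · = q)` throughout). [folklore] -/
theorem mem_fiber_iff' [Fintype G] [DecidableEq Q] (π : G →+ Q) (q : Q) (g : G) :
    g ∈ (univ.filter fun g => π g = q) ↔ π g = q := by
  simp

/-- Translating the fibre over `q` by minus a preimage of `q` gives the zero fibre; so all fibres have the same size.
[folklore] -/
theorem card_fiber_eq [Fintype G] [DecidableEq Q] (π : G →+ Q) {q : Q} {g₀ : G} (hg₀ : π g₀ = q) :
    (univ.filter fun g => π g = q).card = (univ.filter fun g => π g = 0).card := by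
  refine card_bij' (fun g _ => g - g₀) (fun g _ => g + g₀) (fun g hg => ?_) (fun g hg => ?_)
    (fun g _ => by simp) (fun g _ => by simp)
  · rw [mem_fiber_iff'] at hg ⊢
    rw [map_sub, hg, hg₀, sub_self]
  · rw [mem_fiber_iff'] at hg ⊢
    rw [map_add, hg, hg₀, zero_add]

/-- For a surjection of finite abelian groups every fibre has `|G| / |Q|` elements: `|fibre| · |Q| = |G|`.
[folklore] -/
theorem card_fiber_mul_card [Fintype G] [Fintype Q] [DecidableEq Q] (π : G →+ Q) (hπ : Function.Surjective π)
    (q : Q) : (univ.filter fun g => π g = q).card * Fintype.card Q = Fintype.card G := by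
  have h : Fintype.card G = ∑ b : Q, (univ.filter fun g => π g = b).card := by
    rw [← card_univ, card_eq_sum_card_fiberwise (f := π) (t := univ) fun g _ => mem_coe.2 (mem_univ _)]
  have hconst : ∀ b : Q, (univ.filter fun g => π g = b).card = (univ.filter fun g => π g = q).card := by
    intro b
    obtain ⟨g, hg⟩ := hπ b
    obtain ⟨g', hg'⟩ := hπ q
    rw [card_fiber_eq π hg, card_fiber_eq π hg']
  rw [h, Finset.sum_congr rfl fun b _ => hconst b, sum_const, card_univ, smul_eq_mul, mul_comm]

/-- The image of a fibre of a surjection is the point. [folklore] -/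
theorem image_fiber [Fintype G] [DecidableEq Q] (π : G →+ Q) (hπ : Function.Surjective π) (q : Q) :
    (univ.filter fun g => π g = q).image π = {q} := by
  ext x
  simp only [mem_image, mem_fiber_iff', mem_singleton]
  constructor
  · rintro ⟨g, hg, rfl⟩; exact hg
  · rintro rfl; obtain ⟨g, hg⟩ := hπ x; exact ⟨g, hg, hg⟩

/-- Lifting a finset along a section `σ` of `π`: the lift is mapped injectively by `π`. [folklore] -/
theorem injOn_image_section [DecidableEq G] (π : G →+ Q) {σ : Q → G} (hσ : ∀ q, π (σ q) = q) (S : Finset Q) :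
    Set.InjOn π (S.image σ : Finset G) := by
  intro x hx y hy hxy
  rw [mem_coe, mem_image] at hx hy
  obtain ⟨a, -, rfl⟩ := hx
  obtain ⟨b, -, rfl⟩ := hy
  rw [hσ, hσ] at hxy
  rw [hxy]

/-- A lift along a section has the cardinality of the set. [folklore] -/
theorem card_image_section [DecidableEq G] (π : G →+ Q) {σ : Q → G} (hσ : ∀ q, π (σ q) = q) (S : Finset Q) :
    (S.image σ).card = S.card :=
  card_image_of_injective _ (Function.LeftInverse.injective hσ)

/-- A lift along a section projects back onto the set. [folklore] -/
theorem image_image_section [DecidableEq G] [DecidableEq Q] (π : G →+ Q) {σ : Q → G} (hσ : ∀ q, π (σ q) = q)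
    (S : Finset Q) : (S.image σ).image π = S := by
  rw [image_image]
  convert image_id (s := S) using 2
  funext q; exact hσ q

end Fiber

/-! ## The index-2 lift: singleton-mixed families in `Q` give `(2,2,2)^N` in `G` -/

section IndexTwo

variable {G Q : Type*} [AddCommGroup G] [AddCommGroup Q] [Fintype G] [DecidableEq G] [Fintype Q] [DecidableEq Q]
  {N : ℕ}

/-- **Index-2 lift of singleton-mixed STPP families.** Let `π : G →+ Q` be a surjection of finite abelian groups with
`|G| = 2|Q|` (kernel of order `2`).  If `Q` hosts an STPP family `(A'ᵢ, B'ᵢ, C'ᵢ)_{i<N}` in which every triple has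
the size pattern `(1,2,2)`, `(2,1,2)` or `(2,2,1)`, then `G` hosts `(2,2,2)^N`: replace the singleton of each triple by
its full fibre (two elements, image one point) and lift the two 2-sets along a section of `π` (`isSTPP_of_image`).
[cite: CohnKleinbergSzegedyUmans2005, Def. 5.1] -/
theorem exists_isSTPP_222pow_of_card_eq_two_mul (π : G →+ Q) (hπ : Function.Surjective π)
    (hcard : Fintype.card G = 2 * Fintype.card Q) {A' B' C' : Fin N → Finset Q} (hS : IsSTPP A' B' C')
    (hpat : ∀ i, ((A' i).card = 1 ∧ (B' i).card = 2 ∧ (C' i).card = 2) ∨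
      ((A' i).card = 2 ∧ (B' i).card = 1 ∧ (C' i).card = 2) ∨ ((A' i).card = 2 ∧ (B' i).card = 2 ∧ (C' i).card = 1)) :
    ∃ A B C : Fin N → Finset G, IsSTPP A B C ∧ ∀ i, (A i).card = 2 ∧ (B i).card = 2 ∧ (C i).card = 2 := by
  -- a section of `π`
  set σ : Q → G := Function.surjInv hπ with hσdef
  have hσ : ∀ q, π (σ q) = q := Function.surjInv_eq hπ
  -- fibres have two elements
  have hQpos : 0 < Fintype.card Q := Fintype.card_pos
  have hfib : ∀ q, (univ.filter fun g => π g = q).card = 2 := by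
    intro q
    have h := card_fiber_mul_card π hπ q
    rw [hcard] at h
    exact Nat.eq_of_mul_eq_mul_right hQpos h
  -- the lift of a set: the full fibre if it is a singleton, the section image otherwise
  let lift : Finset Q → Finset G := fun S => if S.card = 1 then univ.filter (fun g => π g ∈ S) else S.image σ
  have lift_one : ∀ S : Finset Q, S.card = 1 → ∃ q, S = {q} ∧ lift S = univ.filter fun g => π g = q := by
    intro S hS
    obtain ⟨q, rfl⟩ := card_eq_one.1 hS
    refine ⟨q, rfl, ?_⟩
    simp only [lift, card_singleton, if_true, mem_singleton]
  have lift_two : ∀ S : Finset Q, S.card = 2 → lift S = S.image σ := by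
    intro S hS
    simp only [lift, hS, if_neg (by norm_num : (2 : ℕ) ≠ 1)]
  have image_lift : ∀ S : Finset Q, S.card = 1 ∨ S.card = 2 → (lift S).image π = S := by
    rintro S (hS | hS)
    · obtain ⟨q, rfl, hq⟩ := lift_one S hS
      rw [hq, image_fiber π hπ]
    · rw [lift_two S hS, image_image_section π hσ]
  have card_lift : ∀ S : Finset Q, S.card = 1 ∨ S.card = 2 → (lift S).card = 2 := by
    rintro S (hS | hS)
    · obtain ⟨q, rfl, hq⟩ := lift_one S hS
      rw [hq, hfib]
    · rw [lift_two S hS, card_image_section π hσ, hS]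
  have inj_lift : ∀ S : Finset Q, S.card = 2 → Set.InjOn π (lift S : Finset G) := by
    intro S hS
    rw [lift_two S hS]
    exact injOn_image_section π hσ S
  refine ⟨fun i => lift (A' i), fun i => lift (B' i), fun i => lift (C' i), ?_, fun i => ?_⟩
  · apply isSTPP_of_image π
    · have hA : (fun i => (lift (A' i)).image π) = A' :=
        funext fun i => image_lift _ (by rcases hpat i with h | h | h <;> simp [h])
      have hB : (fun i => (lift (B' i)).image π) = B' :=
        funext fun i => image_lift _ (by rcases hpat i with h | h | h <;> simp [h])
      have hC : (fun i => (lift (C' i)).image π) = C' :=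
        funext fun i => image_lift _ (by rcases hpat i with h | h | h <;> simp [h])
      rw [hA, hB, hC]
      exact hS
    · intro i
      rcases hpat i with ⟨-, hB, hC⟩ | ⟨hA, -, hC⟩ | ⟨hA, hB, -⟩
      · exact Or.inl ⟨inj_lift _ hB, inj_lift _ hC⟩
      · exact Or.inr (Or.inl ⟨inj_lift _ hA, inj_lift _ hC⟩)
      · exact Or.inr (Or.inr ⟨inj_lift _ hA, inj_lift _ hB⟩)
  · rcases hpat i with ⟨hA, hB, hC⟩ | ⟨hA, hB, hC⟩ | ⟨hA, hB, hC⟩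
    · exact ⟨card_lift _ (Or.inl hA), card_lift _ (Or.inr hB), card_lift _ (Or.inr hC)⟩
    · exact ⟨card_lift _ (Or.inr hA), card_lift _ (Or.inl hB), card_lift _ (Or.inr hC)⟩
    · exact ⟨card_lift _ (Or.inr hA), card_lift _ (Or.inr hB), card_lift _ (Or.inl hC)⟩

end IndexTwo

/-! ## The cyclic case `ℤ/2n → ℤ/n` -/

/-- **Singleton-mixed families of `ℤ/n` give `(2,2,2)^N ⊆ ℤ/2n`** (`n ≥ 1`): the reduction map `ℤ/2n → ℤ/n` is a
surjection with fibres of size `2` (for `n` even the extension does not split).  This is the census's "coset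
mechanism": the lifted family has in every triple a coset `{x, x+n}` of the order-2 subgroup.
[cite: CohnKleinbergSzegedyUmans2005, Def. 5.1] -/
theorem exists_isSTPP_222pow_zmod_two_mul {n N : ℕ} [NeZero n] {A' B' C' : Fin N → Finset (ZMod n)}
    (hS : IsSTPP A' B' C')
    (hpat : ∀ i, ((A' i).card = 1 ∧ (B' i).card = 2 ∧ (C' i).card = 2) ∨
      ((A' i).card = 2 ∧ (B' i).card = 1 ∧ (C' i).card = 2) ∨ ((A' i).card = 2 ∧ (B' i).card = 2 ∧ (C' i).card = 1)) :
    ∃ A B C : Fin N → Finset (ZMod (2 * n)), IsSTPP A B C ∧ ∀ i, (A i).card = 2 ∧ (B i).card = 2 ∧ (C i).card = 2 := by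
  haveI : NeZero (2 * n) := ⟨by have := NeZero.ne n; omega⟩
  have hdvd : n ∣ 2 * n := Dvd.intro_left 2 rfl
  exact exists_isSTPP_222pow_of_card_eq_two_mul ((ZMod.castHom hdvd (ZMod n)).toAddMonoidHom)
    (ZMod.castHom_surjective hdvd) (by rw [ZMod.card, ZMod.card]) hS hpat

/-! ## Worked instance: `ℤ/46 → ℤ/92` -/

/-- **`ℤ/46` hosts five simultaneous-TPP triples with size patterns `(2,2,1),(2,2,1),(2,1,2),(2,1,2),(2,2,1)`** — the
projection of the census witness `exists_isSTPP_222pow5_zmod92` (`STPP222Pow5CyclicWitnesses9294.lean`) along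
`ℤ/92 → ℤ/46` (each coset `{x, x+46}` becomes the singleton `{x mod 46}`); kernel evaluation of the Boolean Def-5.1
checker `stppCheck` on the lists `A = [0,4],[0,4],[0,16],[0,16],[0,23]`, `B = [0,23],[45,22],[29],[28],[26,38]`,
`C = [0],[1],[9,32],[4,27],[33]`. [cite: CohnKleinbergSzegedyUmans2005, Def. 5.1] -/
theorem exists_isSTPP_mixed5_zmod46 :
    ∃ A B C : Fin 5 → Finset (ZMod 46), IsSTPP A B C ∧
      ∀ i, ((A i).card = 1 ∧ (B i).card = 2 ∧ (C i).card = 2) ∨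
        ((A i).card = 2 ∧ (B i).card = 1 ∧ (C i).card = 2) ∨ ((A i).card = 2 ∧ (B i).card = 2 ∧ (C i).card = 1) := by
  refine ⟨fun i => ((![[0, 4], [0, 4], [0, 16], [0, 16], [0, 23]] : Fin 5 → List (ZMod 46)) i).toFinset,
    fun i => ((![[0, 23], [45, 22], [29], [28], [26, 38]] : Fin 5 → List (ZMod 46)) i).toFinset,
    fun i => ((![[0], [1], [9, 32], [4, 27], [33]] : Fin 5 → List (ZMod 46)) i).toFinset,
    isSTPP_of_stppCheck (by decide +kernel), by decide⟩

/-- **`(2,2,2)⁵ ⊆ ℤ/92` by the coset mechanism**: the index-2 lift of `exists_isSTPP_mixed5_zmod46` (a second proof of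
the census row `exists_isSTPP_222pow5_zmod92` of `STPP222Pow5CyclicWitnesses9294.lean`, through `ℤ/92 → ℤ/46`).
[cite: CohnKleinbergSzegedyUmans2005, Def. 5.1] -/
theorem exists_isSTPP_222pow5_zmod92' :
    ∃ A B C : Fin 5 → Finset (ZMod (2 * 46)), IsSTPP A B C ∧ ∀ i, (A i).card = 2 ∧ (B i).card = 2 ∧ (C i).card = 2 := by
  obtain ⟨A', B', C', hS, hpat⟩ := exists_isSTPP_mixed5_zmod46
  exact exists_isSTPP_222pow_zmod_two_mul hS hpat

/-! ## Appendix (gen 9, same day): the converse direction — DESCENT of saturated families along `π`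

The lift `isSTPP_of_image` has a converse for families that are "saturated often enough".  Call a set `S ⊆ G` *`π`-saturated* if it
is a union of fibres (`g ∈ S`, `π w = 0` ⇒ `g + w ∈ S`); a full fibre (a coset of `ker π`) is saturated.  In the Def-5.1 word
`(s' − s) + (t' − t) + (u' − u)` (`s' ∈ A_i, s ∈ A_k, t ∈ B_i, t' ∈ B_j, u ∈ C_j, u' ∈ C_k`) suppose that for EVERY index triple
`(i, j, k)` at least one of the six letters ranges over a saturated set.  Then a vanishing IMAGE word lifts to a vanishing word of
`G` (absorb the kernel element into the saturated letter), so the image family is an STPP family of `Q` (`isSTPP_image_of_saturated`).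
For COSET families of `ℤ/2n` (one coset `{x, x+n}` per triple) the hypothesis holds exactly when the cosets occupy at most TWO of the
three positions `A, B, C` (`…_of_two_positions`): then the index `i` (positions `A,B`), `j` (positions `B,C`) or `k` (positions `C,A`)
always supplies a saturated letter.  Together with the lift this is the census's desk inference (c) in kernel form: a 2-position
coset family of `ℤ/2n` IS the lift of a (singleton-mixed) STPP family of `ℤ/n`; 3-position coset families need not descend (the
`ℤ/80`, `ℤ/94` witnesses do not — cell STATUS 2026-08-24T11:21Z). -/

section Descent

variable {G Q : Type*} [AddCommGroup G] [AddCommGroup Q] [DecidableEq Q] {N : ℕ}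

/-- A full fibre `{g | π g = q}` is `π`-SATURATED: stable under adding kernel elements (the saturation condition is written
out as `∀ g ∈ S, ∀ w, π w = 0 → g + w ∈ S` throughout; no definition is introduced). [folklore] -/
theorem fiber_saturated [Fintype G] (π : G →+ Q) (q : Q) :
    ∀ g ∈ (univ.filter fun g => π g = q), ∀ w : G, π w = 0 → g + w ∈ (univ.filter fun g => π g = q) := by
  intro g hg w hw
  rw [mem_filter] at hg ⊢
  exact ⟨mem_univ _, by rw [map_add, hg.2, hw, add_zero]⟩

/-- **Descent of STPP families along a homomorphism.** Let `π : G →+ Q` and let `(Aᵢ, Bᵢ, Cᵢ)_{i<N}` be an STPP family in `G`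
such that for every index triple `(i, j, k)` at least one of `A_i, B_i` / `B_j, C_j` / `C_k, A_k` is `π`-saturated.  Then the image
family `(π Aᵢ, π Bᵢ, π Cᵢ)` is an STPP family in `Q`: a vanishing image word `(s̄'−s̄)+(t̄'−t̄)+(ū'−ū) = 0` comes from a word `w` of
`G` with `π w = 0`, and replacing the saturated letter `x` by `x ∓ w` gives a vanishing word of `G`.
[cite: CohnKleinbergSzegedyUmans2005, Def. 5.1] -/
theorem isSTPP_image_of_saturated (π : G →+ Q) {A B C : Fin N → Finset G} (hS : IsSTPP A B C)
    (hsat : ∀ i j k : Fin N,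
      (∀ g ∈ A i, ∀ w : G, π w = 0 → g + w ∈ A i) ∨ (∀ g ∈ B i, ∀ w : G, π w = 0 → g + w ∈ B i) ∨
      (∀ g ∈ B j, ∀ w : G, π w = 0 → g + w ∈ B j) ∨ (∀ g ∈ C j, ∀ w : G, π w = 0 → g + w ∈ C j) ∨
      (∀ g ∈ C k, ∀ w : G, π w = 0 → g + w ∈ C k) ∨ (∀ g ∈ A k, ∀ w : G, π w = 0 → g + w ∈ A k)) :
    IsSTPP (fun i => (A i).image π) (fun i => (B i).image π) (fun i => (C i).image π) := by
  intro i j k sb hsb sb' hsb' tb htb tb' htb' ub hub ub' hub' h0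
  simp only [mem_image] at hsb hsb' htb htb' hub hub'
  obtain ⟨s, hs, rfl⟩ := hsb
  obtain ⟨s', hs', rfl⟩ := hsb'
  obtain ⟨t, ht, rfl⟩ := htb
  obtain ⟨t', ht', rfl⟩ := htb'
  obtain ⟨u, hu, rfl⟩ := hub
  obtain ⟨u', hu', rfl⟩ := hub'
  set w : G := (s' - s) + (t' - t) + (u' - u) with hw
  have hπw : π w = 0 := by rw [hw]; simpa only [map_add, map_sub] using h0
  have hπw' : π (-w) = 0 := by rw [map_neg, hπw, neg_zero]
  -- absorb `w` into the saturated letter; in each case the modified word vanishes in `G`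
  have key : ∀ {s₁ s₁' t₁ t₁' u₁ u₁' : G}, s₁ ∈ A k → s₁' ∈ A i → t₁ ∈ B i → t₁' ∈ B j → u₁ ∈ C j →
      u₁' ∈ C k → (s₁' - s₁) + (t₁' - t₁) + (u₁' - u₁) = 0 → π s₁ = π s → π s₁' = π s' → π t₁ = π t →
      π t₁' = π t' → π u₁ = π u → π u₁' = π u' → i = j ∧ j = k ∧ π s = π s' ∧ π t = π t' ∧ π u = π u' := by
    intro s₁ s₁' t₁ t₁' u₁ u₁' h1 h2 h3 h4 h5 h6 hz e1 e2 e3 e4 e5 e6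
    obtain ⟨hij, hjk, hss, htt, huu⟩ := hS i j k s₁ h1 s₁' h2 t₁ h3 t₁' h4 u₁ h5 u₁' h6 hz
    exact ⟨hij, hjk, by rw [← e1, ← e2, hss], by rw [← e3, ← e4, htt], by rw [← e5, ← e6, huu]⟩
  rcases hsat i j k with hA | hB | hB' | hC | hC' | hA'
  · -- s' ∈ A i saturated: s' ↦ s' + (-w)
    exact key hs (hA s' hs' (-w) hπw') ht ht' hu hu' (by rw [hw]; abel)
      rfl (by rw [map_add, hπw', add_zero]) rfl rfl rfl rfl
  · -- t ∈ B i saturated: t ↦ t + w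
    exact key hs hs' (hB t ht w hπw) ht' hu hu' (by rw [hw]; abel) rfl rfl (by rw [map_add, hπw, add_zero]) rfl rfl rfl
  · -- t' ∈ B j saturated: t' ↦ t' + (-w)
    exact key hs hs' ht (hB' t' ht' (-w) hπw') hu hu' (by rw [hw]; abel) rfl rfl rfl
      (by rw [map_add, hπw', add_zero]) rfl rfl
  · -- u ∈ C j saturated: u ↦ u + w
    exact key hs hs' ht ht' (hC u hu w hπw) hu' (by rw [hw]; abel) rfl rfl rfl rfl (by rw [map_add, hπw, add_zero]) rfl
  · -- u' ∈ C k saturated: u' ↦ u' + (-w)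
    exact key hs hs' ht ht' hu (hC' u' hu' (-w) hπw') (by rw [hw]; abel) rfl rfl rfl rfl rfl
      (by rw [map_add, hπw', add_zero])
  · -- s ∈ A k saturated: s ↦ s + w
    exact key (hA' s hs w hπw) hs' ht ht' hu hu' (by rw [hw]; abel) (by rw [map_add, hπw, add_zero]) rfl rfl rfl rfl rfl

/-- **Two-position coset families descend.** If every triple of an STPP family in `G` has a `π`-saturated set, and these sit
in at most two of the three positions — all in `{A, B}`, or all in `{B, C}`, or all in `{C, A}` — then the image family is an
STPP family in `Q`.  (For `π : ℤ/2n → ℤ/n` and saturated set = coset `{x, x+n}` this is the descent of 2-position coset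
families to singleton-mixed families of `ℤ/n`, the converse of `exists_isSTPP_222pow_zmod_two_mul` on such families.)
[cite: CohnKleinbergSzegedyUmans2005, Def. 5.1] -/
theorem isSTPP_image_of_two_positions (π : G →+ Q) {A B C : Fin N → Finset G} (hS : IsSTPP A B C)
    (hpos : (∀ i, (∀ g ∈ A i, ∀ w : G, π w = 0 → g + w ∈ A i) ∨ (∀ g ∈ B i, ∀ w : G, π w = 0 → g + w ∈ B i)) ∨
      (∀ i, (∀ g ∈ B i, ∀ w : G, π w = 0 → g + w ∈ B i) ∨ (∀ g ∈ C i, ∀ w : G, π w = 0 → g + w ∈ C i)) ∨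
      (∀ i, (∀ g ∈ C i, ∀ w : G, π w = 0 → g + w ∈ C i) ∨ (∀ g ∈ A i, ∀ w : G, π w = 0 → g + w ∈ A i))) :
    IsSTPP (fun i => (A i).image π) (fun i => (B i).image π) (fun i => (C i).image π) := by
  refine isSTPP_image_of_saturated π hS fun i j k => ?_
  rcases hpos with h | h | h
  · rcases h i with h1 | h1
    · exact Or.inl h1
    · exact Or.inr (Or.inl h1)
  · rcases h j with h1 | h1
    · exact Or.inr (Or.inr (Or.inl h1))
    · exact Or.inr (Or.inr (Or.inr (Or.inl h1)))
  · rcases h k with h1 | h1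
    · exact Or.inr (Or.inr (Or.inr (Or.inr (Or.inl h1))))
    · exact Or.inr (Or.inr (Or.inr (Or.inr (Or.inr h1))))

end Descent

/-- **Product form of the index-2 lift** (Appendix 2, gen 9): a singleton-mixed `(1,2,2)/(2,1,2)/(2,2,1)` STPP family of a finite
abelian group `Q` gives `(2,2,2)^N ⊆ ℤ/2 × Q` (fibre lift along `AddMonoidHom.snd : ℤ/2 × Q →+ Q`); e.g. the `ℤ/46` family above yields the
census cell `ℤ/2 × ℤ/46` (explicit witness `exists_isSTPP_222pow5_z2_z46`, `STPP222Pow5NonCyclicWitnesses.lean`). [cite: CohnKleinbergSzegedyUmans2005, Def. 5.1] -/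
theorem exists_isSTPP_222pow_prod_zmod_two {Q : Type} [AddCommGroup Q] [Fintype Q] [DecidableEq Q] {N : ℕ}
    {A' B' C' : Fin N → Finset Q} (hS : IsSTPP A' B' C')
    (hpat : ∀ i, ((A' i).card = 1 ∧ (B' i).card = 2 ∧ (C' i).card = 2) ∨
      ((A' i).card = 2 ∧ (B' i).card = 1 ∧ (C' i).card = 2) ∨ ((A' i).card = 2 ∧ (B' i).card = 2 ∧ (C' i).card = 1)) :
    ∃ A B C : Fin N → Finset (ZMod 2 × Q), IsSTPP A B C ∧ ∀ i, (A i).card = 2 ∧ (B i).card = 2 ∧ (C i).card = 2 :=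
  exists_isSTPP_222pow_of_card_eq_two_mul (AddMonoidHom.snd (ZMod 2) Q) (fun q => ⟨(0, q), rfl⟩)
    (by rw [Fintype.card_prod, ZMod.card]) hS hpat

end Summit.MatrixMultiplication.OmegaCensus
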